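import Mathlib
import Summits.BirchSwinnertonDyer.Rank1Residual.Additive.PotSupersingularTargets
import Summits.BirchSwinnertonDyer.Rank1Residual.X4.KimTamagawaDefect
import Literature.NumberTheory.EllipticCurves.Kobayashi2003.PlusDivisibilityCyclotomicThree
import Literature.NumberTheory.EllipticCurves.Kato2004.Condition1252
import Literature.NumberTheory.EllipticCurves.Rank1Residual.Typed.Basic
import Literature.NumberTheory.EllipticCurves.KuriharaNumberInvariants
import Literature.NumberTheory.EllipticCurves.AnalyticRankOrderProofs
import Literature.NumberTheory.EllipticCurves.BSDRootNumberNoContinuationProofs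
import HarnessLib

/-!
# O5 targets at `p = 3` — T-O5-A and its attack forms (cell `b2b-bsdres`, lane CLASS-CLOSURE, team o5;
# content = planner o5-r1 (Iwasawa side), placement + dedup = cc-typer-5) — TYPED, NOTHING ASSERTED

HONEST FRAMING (cell `b2b-bsdres`, run/shared/lean/b2b/bsd-rank1-residual/, verbatim in every
file): the goal of the cell is to DELETE the COMBINATION-SHAPED residual classes of the
Birch–Swinnerton-Dyer formula for ALL analytic-rank `≤ 1` elliptic curves over `ℚ` — "full BSD
formula for every rank `≤ 1` curve in class `C`" assembled STRICTLY from published theorems — so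
that the rank-`≤ 1` remainder becomes exactly the CONSTRUCTION-SHAPED classes, which are TYPED
(missing-input `Prop`s), NOT attempted. This is not "finishing BSD". Lane CLASS-CLOSURE
(`CLASS-CLOSURE-PLAN.md` §3.5 O5): research routes; no claim beyond the stated classes; census
output is EVIDENCE / conjecture items, never a Literature fact; no Literature fact is minted here,
no `_holds`, no main conjecture inside any certificate; nothing is booked and no mark of
`RESIDUAL-MAP.md` moves.

Class O5 = `ClassO5 W 3` (`Additive/PotSupersingularClasses.lean`): additive, tame, potentially good
SUPERSINGULAR at `p = 3`; = O5a (`SubGss`, `e = 2`, `W = V ⊗ χ₋₃`, `V` good supersingular) ⊔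
O5b (`SubTprime`, `e = 4`, Kodaira III / III*). This file is ask **A-O5-4** of the o5o6 convergence
file `HOME/cells/o5o6/TARGETS.md` §O5 (sha16 `12688f0362ad85a1` at placement): the CONVERGED typed
target **T-O5-A** "KMC₃ on the O5 local types + additive descent" (EVIDENCE-shaped conjecture,
PRINTED antecedent Kato, Astérisque 295, Conj. 12.10 p. 224 — no reduction hypothesis) and its
attack forms, as written by planner o5-r1 in `HOME/b2b-bsdres-o5-r1/O5Targets.lean` (sha256
`5aff423e0f8a4409…`, farm rc 0), placed by the class typer with three TYPER EDITS (each marked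
`TYPER` below): (1) `KimTamagawaDefectThree` is stated BY NAME over the tree's
`X4.KimTamagawaDefectAt` (n1011-p12, `X4/KimTamagawaDefect.lean`) instead of re-displaying its body
(OWNERS §0 item 7: dedup); (2) the planner's placeholder predicate `IsSignedIwasawaDataOf`
(a `def … : Prop` not mentioning the datum) is replaced by an INTERFACE PARAMETER `IsSignedDatumOf`
— definition requests D1–D3 are not in the tree, so the signed main conjecture is typed OVER the
characterisation, exactly as Kato's Conj. 12.10 enters through the interface `KMC` (o6-r1's
D-O6-2); nothing false is conjectured for an arbitrary datum; (3) kernel links added: the O5 per-pair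
target is implied by the uniform lower-half conjecture `PotGoodLowerHalfRankZero` of
`Additive/PotSupersingularTargets.lean` (gen 0), and the signed attack form composes to
`MissingPPartAt W 3`. EVIDENCE labels in the docstrings are the planner's, verbatim; the long form
with census tests C-A1–C-A3 is `cells/o5o6/TARGETS.md` §O5 (o5-r1 ⟦05:18Z⟧, C-A3 pilot kit
j120899) and `HOME/b2b-bsdres-o5-r1/TARGETS-o5-r1.md`. The companion target T-O5-B (Heegner side,
o5-r2) is `O5/HeegnerIndexThree.lean`.

Contents: §1 T1↓ / T1-KN / T1a (conjecture shells with printed antecedents); §2 the T2 interface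
(D1–D3 OBJECT-CANDIDATE) and the signed main conjecture / constant-term law over it; §3 the shared
O5 ∪ O6 additive-descent shell over the interface `KMC` and its restrictions; §4 kernel bookkeeping.
-/

set_option autoImplicit false

noncomputable section

open scoped Classical MatrixGroups ModularForm

open CongruenceSubgroup WeierstrassCurve Literature.NumberTheory.EllipticCurves
  Literature.NumberTheory.EllipticCurves.ModularForms
  Literature.NumberTheory.GaloisRepresentations
  Literature.NumberTheory.EllipticCurves.Rank1Residual.Typed
  Literature.NumberTheory.EllipticCurves.Kobayashi2003
  Summit.BirchSwinnertonDyer.Rank1Residual.Additive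

namespace Summit.BirchSwinnertonDyer.Rank1Residual.O5

/-! ## §1 T-O5-A per pair, its Kurihara-number currency, and its signed form on O5a -/

/-- **T1↓ (O5, rank 0): the per-pair LOWER half as the consequence of Kato's main conjecture at
`(f_W, 3)`.**  EVIDENCE: *consequence of a conjecture IN PRINT* — Kato, Astérisque 295 (2004)
Conj. 12.10 (p. 224; no reduction-type hypothesis) [corpus: paper:doi-10-24033-ast-639 p0109 L20–23],
combined with C.-H. Kim (app. Pollack) arXiv:2505.09121 Thm 1.1 (PREPRINT 2025; p ≥ 3, large image,
any reduction) and Kim's refined Tamagawa conjecture (Kim 2026 Conj. 1.10 = Kim 2025 Conj. 7.4).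
Binders: `ClassO5 W 3` (tame potentially supersingular additive 3), Kato's (12.5.2)
`ImageContainsSL2 W 3` (= the census `towerSurj3` bit), `L(W,1) ≠ 0`, `Ш` finite.  Conclusion: the
tree's `MissingLowerBoundAt W 3` (`ord₃ #Ш_an ≤ ord₃ #Ш`).  The UPPER half on the same rows is the
kernel theorem V20X / `Kato2004.rankZero_padicValNat_sha_le_sub_localTamagawa_…`.  It is the
`ClassO5`, `p = 3` restriction of the uniform conjecture `PotGoodLowerHalfRankZero`
(`katoIMCThreeLowerHalfRankZero_of_potGoodLowerHalfRankZero`, §4). Conjecture shell. -/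
@[conjecture] def KatoIMCThreeLowerHalfRankZero : Prop :=
  ∀ (W : WeierstrassCurve ℚ) [W.IsElliptic] [W.IsGloballyMinimal],
    ClassO5 W 3 → Kato2004.ImageContainsSL2 W 3 →
    W.entireLFunction 1 ≠ 0 → Finite W.sha →
    MissingLowerBoundAt W 3

/-- **T1-KN (O5, rank 0, census-facing): Kim's refined Tamagawa conjecture at the additive prime 3**
— the `3`-divisibility of the Kurihara numbers of `W` bottoms out exactly at the Tamagawa exponent:
`∂^{(∞)}(δ̃(W)) = ord₃ ∏_ℓ c_ℓ(W)` (on `ClassO5 W 3` one has `c₃(W) ∈ {1,2,4}`, so `∏_ℓ` and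
`∏_{ℓ ≠ 3}` agree).  EVIDENCE: *instance of a conjecture IN PRINT* — Kim, Amer. J. Math. 148 (2026)
Conj. 1.9 (= arXiv:2203.12159v4 Conj. 1.10, PDF p. 8) / Kim arXiv:2505.09121 Conj. 7.4 (additive `p`
allowed); proved at good ordinary `p` (Burungale–Castella–Grossi–Skinner), OPEN at every additive `p`.
Normalisation: the tree's `kuriharaNumber f (3^k) n ψ` is `Ω⁺_f`-normalised; the binder
`Ω(W) = u · Ω⁺_f`, `|u|₃ = 1` restricts to rows where no period index intervenes (the census reports
the index `ι(W)` separately on the other rows, CLASS-CLOSURE-PLAN §3.1 E1).  CENSUS TEST (falsifier):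
on `ClassO5 ∧ towerSurj3 ∧ r_an = 0` rows, `min_n ord₃ δ̃_n` over cyclic Kolyvagin levels with
`ν(n) ≤ 3` must equal `ord₃ ∏ c_ℓ` — one row with a unit `δ̃_n` and `3 ∣ ∏ c_ℓ`, or with all
`δ̃_n ≡ 0 (mod 3^{τ+1})` up to the Chebotarev-predicted level, is an ANOMALY.  Conjecture shell.
TYPER (dedup, OWNERS §0 item 7): the conclusion is the tree's `X4.KimTamagawaDefectAt W 3 f`
(`X4/KimTamagawaDefect.lean`, Kim 2026 Conj. 1.10 at `(W, 3, f)`: `kuriharaPartialInfty W 3 f =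
ord₃ ∏_v c_v`), whose printed sentence `X4.kim2026_conjecture_1_10` carries `5 ≤ p` — this is its
`p = 3` analogue on O5 (`kimTamagawaDefectThree_iff`). -/
@[conjecture] def KimTamagawaDefectThree : Prop :=
  ∀ (W : WeierstrassCurve ℚ) [W.IsElliptic] [W.IsGloballyMinimal]
    {N : ℕ} [NeZero N] (f : CuspForm (Gamma0 N) 2),
    ClassO5 W 3 → Kato2004.ImageContainsSL2 W 3 → IsNewformOf W f →
    (∃ u : ℚ, ‖(u : ℚ_[3])‖ = 1 ∧ W.realPeriodRat = u * plusPeriod f) →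
    W.entireLFunction 1 ≠ 0 →
    X4.KimTamagawaDefectAt W 3 f

/-- The planner's display of T1-KN, definitionally: `∂^{(∞)}(δ̃(W)) = ord₃ ∏_v c_v(W)` in `ℕ∞`.
[cite: Kim2022StructureSelmer, Conj. 1.10 (§1.5.3, PDF p. 8)] -/
theorem kimTamagawaDefectThree_iff :
    KimTamagawaDefectThree ↔
      ∀ (W : WeierstrassCurve ℚ) [W.IsElliptic] [W.IsGloballyMinimal]
        {N : ℕ} [NeZero N] (f : CuspForm (Gamma0 N) 2),
        ClassO5 W 3 → Kato2004.ImageContainsSL2 W 3 → IsNewformOf W f →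
        (∃ u : ℚ, ‖(u : ℚ_[3])‖ = 1 ∧ W.realPeriodRat = u * plusPeriod f) →
        W.entireLFunction 1 ≠ 0 →
        kuriharaPartialInfty W 3 f = (padicValNat 3 W.tamagawaProduct : ℕ∞) :=
  Iff.rfl

/-- **T1a (O5a ∧ `a₃(V) = 0`): the ω-BRANCH SIGNED LOWER DIVISIBILITY at `p = 3`** — the exact
converse companion of the tree fact `Kobayashi2003.thm41_plusCharIdeal_dvd_cyclotomicThree`
(Kobayashi, Invent. Math. 152 (2003) Thm 4.1, p. 8: `Char X⁺(E/K_∞)^η ⊇ (pⁿ L_p⁺(E,η,X))` for EVERY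
`η`, `n = 0` under surjectivity; §5 p. 10 Kato's MC "no assumption on the reduction of E at p";
Thm 7.4 p. 13: Kato ⟺ even ⟺ odd MC) [corpus: paper:doi-10-1007-s00222-002-0265-4 p0008, p0010,
p0013].  Read over `K = ℚ(ζ₃)`: for `V/ℚ` good supersingular at `3` with `a₃ = 0` and `ρ_{V,3^∞}`
onto, EVERY element of `Char_{Λ(Γ)} X⁺(V/ℚ(ζ_{3^∞}))` is an INTEGRAL multiple of
`ϖϖ' · L₃⁺(V,X) · L₃⁺(V,ω,X)` (the `ω`-branch function entering, as in the tree fact, through an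
`Lω ∈ ℚ₃⟦X⟧` pinned by its constant term `e·∑_{a mod 3}(a/3)[a/3]⁻_f`).  Its `X = 0` specialisation
is witness-independent and is what the O5a descent consumes: with the control EQUALITY at layer 0
(`Sel⁺ = Sel` over `ℚ(ζ₃)`; `ω`-part of `Sel_{3^∞}(V/ℚ(ζ₃))` = `Sel_{3^∞}(V^{(−3)}/ℚ)`) it yields
`MissingLowerBoundAt (V^{(−3)}) 3`, i.e. T1↓ on O5a (consumer to be written by additive-p4 /
cc-typer-5 next to `XGssRankZeroCyclotomicThree*.lean`, line V18).  EVIDENCE: *converse half of a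
conjecture IN PRINT* (Kobayashi 2003 MC on the `ω`-branch ⟺ Kato Conj 12.10 for `f_{V⊗ω}`); known
cases of the ± MC (Wan; CCSS arXiv:1804.10993; BSTW arXiv:2409.01350v2 Thm 1.3/1.5, PRE) are for the
TRIVIAL branch / twists by discriminants prime to `3p` only — the `η = ω` branch is in none of them.
The `a₃(V) = ±3` sub-case (`c₃(W) = 1`, 3 838 X4 pairs) is the same statement in Sprung's ♯/♭
currency (JNT 132 (2012) Thm 7.16 / Main Conj. 7.21, pp. 1504–1505) — not typed here (the tree has
`Sprung2017.SharpFlatPAdicLFunction` for the trivial branch only).  Conjecture shell, sign `+`. -/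
@[conjecture] def KobayashiOmegaBranchLowerDivisibilityThree : Prop :=
  ∀ (V : WeierstrassCurve ℚ) [V.IsElliptic] [V.IsGloballyMinimal]
    (K : Type) [Field K] [NumberField K] [IsCyclotomicExtension {3} ℚ K]
    (V' : WeierstrassCurve K) [V'.IsElliptic]
    {κ : ZpExtension K 3} {γ : Field.absoluteGaloisGroup K} {N : ℕ} [NeZero N]
    {f : CuspForm (Gamma0 N) 2},
    V.HasGoodReductionAtPrime 3 → V.frobeniusTrace 3 = 0 →
    (∀ m : ℕ, V.HasSurjectiveModNGaloisRep (3 ^ m : ℕ)) →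
    (∃ C : VariableChange K, C • V.baseChange K = V') →
    κ.IsCyclotomic → κ.IsTopGenerator γ →
    (∃ ζ : ℤ_[3]ˣ, IsOfFinOrder ζ ∧
      ((GaloisRep.cyclotomicCharacter K 3 γ * ζ : ℤ_[3]ˣ) : ℤ_[3]) =
        (cyclotomicGenerator 3 : ℤ_[3])) →
    IsNewformOf V f →
    ∀ (L : IwasawaAlgebra 3), IsSignedPAdicLFunction f 3 1 L →
    ∀ (D : SignedSelmerDualData V' κ γ 1) (ϖ ϖ' : ℚ),
      (ϖ : ℝ) * V.realPeriodRat = plusPeriod f →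
      (ϖ' : ℝ) * V.imaginaryPeriodRat = minusPeriod f →
      ∃ Lω : PowerSeries ℚ_[3],
        (∃ e : ℤ_[3]ˣ, PowerSeries.constantCoeff Lω =
          ((e : ℤ_[3]) : ℚ_[3]) *
            ((∑ a : ZMod 3, (legendreSym 3 (a.val : ℤ) : ℚ) * ratMinusSymbol f ((a.val : ℚ) / 3) : ℚ) :
              ℚ_[3])) ∧
        ∀ g ∈ D.charIdeal, ∃ h : IwasawaAlgebra 3,
          iwasawaToPowerSeries 3 g =
            iwasawaToPowerSeries 3 h * PowerSeries.C ((ϖ : ℚ_[3]) * (ϖ' : ℚ_[3])) *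
              (iwasawaToPowerSeries 3 L * Lω)

/-! ## §2 T-O5-A♯ — the signed (BKNO-shaped) attack form: interface D1–D3 + conjecture shells over it -/

/-- **T2 interface (D1–D3 = DEFINITION REQUESTS, OBJECT-CANDIDATE)**: the data a SIGNED Iwasawa
theory of `W` at the additive potentially supersingular prime `3` must deliver — formulated on the
Iwasawa side from Burungale–Kobayashi–Nakamura–Ota, arXiv:2508.17776 (PREPRINT 2025) Thm 1.3
[corpus: paper:arxiv-2508.17776 p0005 L43–80; Def 1.1 p0004 L69–79; programme statement p0004
L34–44, p0009 L20–35]: for the cyclotomic deformation `𝒯 = T₃W ⊗ Λ^ι` of the (generic, symplectic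
self-dual, rank-two) `G_{ℚ₃}`-representation `T₃W` — generic because `W[3]|G_{ℚ₃}` is irreducible on
`ClassO5` — the LOCAL SIGN DECOMPOSITION `H¹_Iw(ℚ₃,T₃W) = H¹_+ ⊕ H¹_−` into free rank-one Lagrangian
`Λ`-submodules specialising to the Bloch–Kato subgroups by the sign `−ε̂₃(T₃W ⊗ χ)`.
D1 (`signCondition±`): that decomposition as a typed object; D2 (`LPlus/LMinus`): the coordinates of
`loc₃ z^{Kato}_W` (Kato's zeta element, Astérisque 295 Thm 12.5) in `H¹_± ≅ Λ`, two INTEGRAL power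
series — the bounded counterparts of Delbourgo's "two p-adic L-functions … not in Λ ⊗ ℚ_p"
(Compositio 1998 p. 152); D3 (`charPlus/charMinus`): characteristic power series of the duals of the
signed Selmer groups `Sel^±(W/ℚ_∞)` cut out by `H¹_∓`... orthogonal complements.  The structure only
NAMES the four elements; their characterisation ("`D` IS the signed datum of `W` at `3`") is the
INTERFACE PARAMETER `IsSignedDatumOf` of the shells below (TYPER edit: o5-r1's placeholder
predicate is not landed — never smuggled into the interface).  Nothing asserted. -/
structure SignedIwasawaData (W : WeierstrassCurve ℚ) where
  /-- D3: a characteristic power series of `Sel⁺(W/ℚ_∞)^∨`. -/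
  charPlus : IwasawaAlgebra 3
  /-- D3: a characteristic power series of `Sel⁻(W/ℚ_∞)^∨`. -/
  charMinus : IwasawaAlgebra 3
  /-- D2: `pr_+ (loc₃ z^{Kato}_W)`. -/
  LPlus : IwasawaAlgebra 3
  /-- D2: `pr_− (loc₃ z^{Kato}_W)`. -/
  LMinus : IwasawaAlgebra 3

section SignedAttackForm

/- INTERFACE for D1–D3 (definition requests, `cells/o5o6/TARGETS.md` §O5 T-O5-A♯): `IsSignedDatumOf W D`
= "the four fields of `D` ARE the objects D1–D3 describe for `W` at `3`". Every shell below is stated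
over ANY such characterisation; when D1–D3 land as definitions the shells are instantiated at it. -/
variable (IsSignedDatumOf :
  ∀ (W : WeierstrassCurve ℚ) [W.IsElliptic] [W.IsGloballyMinimal], SignedIwasawaData W → Prop)

/-- **T2 (O5, NEW FORMULATION on the Iwasawa side; OBJECT-CANDIDATE — not a conjecture in print):
the SIGNED MAIN CONJECTURE at an additive potentially supersingular `3`**:
`char_Λ Sel^±(W/ℚ_∞)^∨ = (L^±₃(W))` for both signs, each sign being equivalent (Poitou–Tate, as in
Kobayashi 2003 Thm 7.4) to Kato's Conj 12.10 for `(f_W, 3)`.  Printed antecedents: BKNO 2025 Thm 1.3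
(the local signs; PRE), Kato 2004 Conj 12.10 / Thm 12.5 (zeta element, one divisibility), Kobayashi
2003 (the `e = 2`, `a₃(V) = 0` model case, where T2 must REPRODUCE Pollack's `L₃^±(V, ω, X)` — census
consistency test C1), Lei–Palvannan arXiv:2412.16629 Thm 4.5 + §4.3 (the Mazur–Tate λ-growth the
signed pair must explain; PRE), Delbourgo 1998 p. 152 (forecast).  CENSUS TEST C2 (falsifier, O5b):
the Mazur–Tate λ-law `λ(θ_n(W)) = A_τ(n) + λ^{ε_n}` with `A_τ` depending ONLY on the local inertial
type `τ` of `W` at `3` and `λ^± ≥ 0` eventually 2-periodic, `= 0` iff `3 ∤ #Ш_an(W)·∏ c_ℓ(W)` on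
`r_an = 0` rows (TARGETS.md §O5 T2).  Conjecture shell over the interface (TYPER: global form
`∀ W D, ClassO5 → (12.5.2) → IsSignedDatumOf W D → …`; for a fixed characterisation it is ONE
`Prop`). -/
@[conjecture] def SignedMainConjectureThree : Prop :=
  ∀ (W : WeierstrassCurve ℚ) [W.IsElliptic] [W.IsGloballyMinimal] (D : SignedIwasawaData W),
    ClassO5 W 3 → Kato2004.ImageContainsSL2 W 3 → IsSignedDatumOf W D →
    Associated D.charPlus D.LPlus ∧ Associated D.charMinus D.LMinus

/-- **T2, rank-0 constant-term clause (what the descent to `BSD₃(W)` consumes; OBJECT-CANDIDATE)**: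
at the trivial character the `+` objects specialise to the classical quantities —
`L⁺₃(W)(0) ∼ L(W,1)/Ω(W)` (Kato's explicit reciprocity law at an additive prime: dual exponential of
`z^{Kato}`, Astérisque 295 Thm 12.5 (1)) and `char⁺(0) ∼ #Ш(W)[3^∞] · ∏_ℓ c_ℓ(W) / #W(ℚ)[3^∞]²`
(control at layer 0 + Euler characteristic) — so that `SignedMainConjectureThree` at `X = 0` reads
`MissingPPartAt W 3`.  Typed as the implication the census can test row by row. Conjecture shell
over the interface. -/
@[conjecture] def SignedConstantTermLawThree : Prop :=
  ∀ (W : WeierstrassCurve ℚ) [W.IsElliptic] [W.IsGloballyMinimal] (D : SignedIwasawaData W),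
    ClassO5 W 3 → Kato2004.ImageContainsSL2 W 3 → IsSignedDatumOf W D →
    W.entireLFunction 1 ≠ 0 → Finite W.sha →
    Associated D.charPlus D.LPlus → MissingPPartAt W 3

/-- **The attack form composes to the class output** (kernel bookkeeping, nothing asserted): given a
characterisation, a datum `D` of `W` satisfying it (= D1–D3 CONSTRUCTED for `W`), the signed main
conjecture and the constant-term law, one gets `MissingPPartAt W 3` on a rank-`0` O5 pair with
Kato's (12.5.2). [folklore] -/
theorem missingPPartAt_of_signedMainConjecture_of_constantTermLaw
    (hMC : SignedMainConjectureThree IsSignedDatumOf)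
    (hCT : SignedConstantTermLawThree IsSignedDatumOf)
    (W : WeierstrassCurve ℚ) [W.IsElliptic] [W.IsGloballyMinimal] (D : SignedIwasawaData W)
    (hO : ClassO5 W 3) (himg : Kato2004.ImageContainsSL2 W 3) (hD : IsSignedDatumOf W D)
    (hL : W.entireLFunction 1 ≠ 0) (hfin : Finite W.sha) : MissingPPartAt W 3 :=
  hCT W D hO himg hD hL hfin (hMC W D hO himg hD).1

end SignedAttackForm

/-! ## §3 The shared O5 ∪ O6 additive-descent shell (T-O5-A (d1) = T-O6-A (A0)), over the interface `KMC` -/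

section SharedDescent

/- Interface for Kato's main conjecture Conj. 12.10 at `(f_W, p)` (o6-r1's definition request D-O6-2
`Kato2004.MainConjecture W p : Prop`; statement only, never a Literature fact — a conjecture; until
it is defined over the tree's Iwasawa-cohomology vocabulary every consumer carries `KMC` explicitly). -/
variable (KMC : ∀ (W : WeierstrassCurve ℚ) [W.IsElliptic] [W.IsGloballyMinimal] (p : ℕ), Prop)

/-- **Shared additive-descent shell (d1) for O5 ∪ O6 — ONE lemma for both FORMULATE teams.**
`KMC₃ ⇒ the r0 LOWER half` on every tame-potentially-supersingular (O5) or wild (O6) additive pair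
with Kato's (12.5.2).  Printed antecedents: Kato Conj. 12.10 (p. 224) + Prop. 14.16(2) (p. 244) read as
an EQUALITY with the additive local index `exp* H¹_f(ℚ₃,T) = c₃·3^{−t}ℤ₃` (Kim 2026 §3.2.3; `t = 0` and
`3 ∤ c₃` on O5) + the `ℓ ≠ 3` Tamagawa equality (Kim 2025 Conj. 7.4, additive case).  Mirrors o6-r1's
`O6Sketch.LowerHalfRankZeroOfKMC` with the class binder widened (its `ClassX4 ∧ SubW` restriction
is `O6/O6Targets.lean`); `T-O5-A` per pair (`KatoIMCThreeLowerHalfRankZero`) is its `ClassO5`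
restriction once `KMC := Kato2004.MainConjecture`.  EVIDENCE: consequence of a conjecture in print.
Nothing asserted. -/
@[conjecture] def PotSupersingularLowerHalfRankZeroOfKMC : Prop :=
  ∀ (W : WeierstrassCurve ℚ) [W.IsElliptic] [W.IsGloballyMinimal],
    (ClassO5 W 3 ∨ ClassO6 W 3) → Kato2004.ImageContainsSL2 W 3 → KMC W 3 →
    W.entireLFunction 1 ≠ 0 → Finite W.sha → MissingLowerBoundAt W 3

/-- The O5 target is the `ClassO5` restriction of the shared shell (kernel-checked bookkeeping):
GIVEN Kato's main conjecture on the O5 rows with (12.5.2) (hypothesis `hKMC`, explicit — nothing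
is credited), the shared shell yields `KatoIMCThreeLowerHalfRankZero`. [folklore] -/
theorem katoIMCThreeLowerHalfRankZero_of_shared
    (hKMC : ∀ (W : WeierstrassCurve ℚ) [W.IsElliptic] [W.IsGloballyMinimal],
      ClassO5 W 3 → Kato2004.ImageContainsSL2 W 3 → KMC W 3)
    (h : PotSupersingularLowerHalfRankZeroOfKMC KMC) : KatoIMCThreeLowerHalfRankZero := by
  intro W _ _ h5 himg hL hfin
  exact h W (Or.inl h5) himg (hKMC W h5 himg) hL hfin

end SharedDescent

/-! ## §4 Kernel links to the gen-0 typed layer (`Additive/PotSupersingularTargets.lean`) -/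

/-- `L(W,1) ≠ 0` forces analytic rank `0` in the tree's convention (order of vanishing of the
entire continuation; junk branch has rank `0`). [cite: BirchSwinnertonDyer1965] -/
theorem analyticRank_eq_zero_of_entireLFunction_one_ne_zero (W : WeierstrassCurve ℚ) [W.IsElliptic]
    (hL : W.entireLFunction 1 ≠ 0) : W.analyticRank = 0 := by
  by_cases hE : W.HasEntireLFunction
  · exact (W.analyticRank_eq_zero_iff_holds hE).mpr hL
  · exact W.analyticRank_eq_zero_of_not_hasEntireLFunction hE

/-- **The O5 per-pair target T1↓ is a restriction of the UNIFORM rank-`0` lower-half conjecture**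
`PotGoodLowerHalfRankZero` (every odd potentially good additive prime; Kato Conj. 12.10 / [BK2] TNC
at `T = 0`): `ClassO5 W 3` gives `Addv W 3` and `0 ≤ ord₃ j(W)`, and `L(W,1) ≠ 0` gives analytic
rank `0`; the image and finiteness binders of T1↓ are not even used. [folklore] -/
theorem katoIMCThreeLowerHalfRankZero_of_potGoodLowerHalfRankZero (h : PotGoodLowerHalfRankZero) :
    KatoIMCThreeLowerHalfRankZero := by
  intro W _ _ hO _himg hL _hfin
  haveI : Fact (Nat.Prime 3) := ⟨Nat.prime_three⟩
  exact h W 3 (analyticRank_eq_zero_of_entireLFunction_one_ne_zero W hL) hO.addv.1 hO.addv.2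
    hO.padicValRat_j_nonneg

end Summit.BirchSwinnertonDyer.Rank1Residual.O5

end
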